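import Literature.MathematicalPhysics.QuantumFieldTheory.Balaban1983to89.Node00.OpsYRecordV4P
import Literature.MathematicalPhysics.QuantumFieldTheory.Balaban1983to89.Node00.OpsYNablaBridge
import Literature.MathematicalPhysics.QuantumFieldTheory.Balaban1983to89.B9Thm311ProjectionR

/-!
# `Δ′_a(U) = Δ_U + Q′(U)* Â Q′(U)` BY NAME at the symmetrised transporter, and `R G′ Δ_U R = R` ([B9] (3.24)–(3.25), p. 394–395)

[B9] = [Balaban1985BackgroundPropagators] T. Bałaban, *Propagators for lattice gauge theories in a background field*, Commun. Math. Phys. **99**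
(1985) 389–434, (3.19)–(3.25) pp. 393–395 and the remark after (3.147) p. 425 («the subspace {A : RD*A = 0}»).

WHAT THIS FILE CHECKS (finite-dimensional algebra over def-Y's landed letters; OWNER file of the `OpsY` instance, cell `pub-ymgap`, node N06).
def-Y's covariant block operator `deltaPrimeAY i par U = lapSL i U + kernelTrOpY (avgCoeffY i) (avgTrY i par U)` (`OpsYDeltaPrimeA`, (3.24)) carries its
averaging term as ONE transported kernel.  Print writes that term as the PRODUCT `Σ_j a_j (L^jη)^{-2} Q′_j(U)* Q′_j(U)` of the covariant block average (3.19)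
and its adjoint.  §1 proves the two agree LETTER BY LETTER at the symmetrised transporter `parSymY` (the R7-repaired table of `OpsYRecordV4`):

  `kernelTrOpY (avgCoeffY i) (avgTrY i (parSymY i) U) = QpsY i (parSymY i) U ∘ Â ∘ QpY i (parSymY i) U`,  `Â = blkScaleY (avgWtY i)`,

`Â` the diagonal block weight `a_{j(s)} · W(s)` (`W(s) = (L^j)^{d+1}` undoes the normalisation `W⁻¹` of def-Y's `Q′` kernel `qpK = QM`), for EVERY
configuration `U` and every coefficient algebra `𝔸` (`avgKernelY_parSymY_eq`, `deltaPrimeAY_parSymY_eq`).  The two inputs are the block bookkeeping of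
n06-j's `B9Thm311DeltaPrimeSymm` (`avgCoeffY_eq_ite`, `cornerY_levY_eq`) and the inverse-symmetry `parSymY_swap` of the transporter table.

§2 draws the STRUCTURAL consequences print uses on p. 425–426 without comment, at every `G`-valued background, `G ≤ U(N)` (where n06-j's
`B9Thm311ProjectionR` makes `R(U)` an idempotent with `Q′G′R = 0` and `B9Thm311DeltaPrimePos` makes `Δ′_a(U)` a unit):
* `RY_GpY_QpsY_parSymY` — `R G′ Q′* = 0` (the mirror of n06-j's `Q′ G′ R = 0`);
* `RY_GpY_avgKernel_parSymY` ∕ `avgKernel_GpY_RY_parSymY` — `R G′ (Q′*ÂQ′) = 0`, `(Q′*ÂQ′) G′ R = 0`;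
* `GpY_comp_lapSL_parSymY` ∕ `lapSL_comp_GpY_parSymY` — `G′Δ_U = 1 − G′(Q′*ÂQ′)`, `Δ_U G′ = 1 − (Q′*ÂQ′)G′`;
* ★ `RY_GpY_lapSL_RY_parSymY` ∕ `RY_lapSL_GpY_RY_parSymY` — **`R G′ Δ_U R = R`** and **`R Δ_U G′ R = R`**;
* in print's units (`G′_phys = η²G′`, `D*_U D_U = c_f² Δ_U`, `c_f η = 1` at every census member): ★★ `RY_GpPhysY_divY_gradY_RY` ∕ `RY_divY_gradY_GpPhysY_RY`
  — **`R G′ D*D R = R`**, **`R D*D G′ R = R`** — and hence ★★ `RY_GpPhysY_divY_gaugePiTY` ∕ `gaugePiY_gradY_GpPhysY_RY`: **`R G′ D* ∘ (1 − DRG′D*) = 0`**,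
  **`(1 − DG′RD*) ∘ D G′ R = 0`** — the gauge modes `D G′ R f` are exactly what the projection (3.119) removes (p. 425: 𝔓 maps onto `{A : RD*A = 0}`).
These are the identities behind the reduction of (3.152) and (3.124) at the record letters (sequel `OpsYIds3152Reduction`).

HONEST SCOPE.  Algebra over landed definitions; no estimate of [B9] is proved or asserted; NOT a discharge of node N06, NOT summit progress; count-neutral;
nothing about the continuum limit, reflection positivity or the mass gap.  Cell `pub-ymgap` (HUMAN RULING D-0062), seat `pub-ymgap-node00-def-Y` (gen 23),
2026-08-28.
-/

namespace Literature.MathematicalPhysics.QuantumFieldTheory.Balaban1983to89.Node00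

open B6MultiLevelBoxOperator (levC aPrinted)
open B6KLevelCensusIndexV1 (KIdx)
open B6Geom246MultiLevelBox (blkOf lev_eq_of_blkOf_eq)
open B6Ineq268MultiLevelBox (W W_pos)
open B9Eq39Adjoint (R R_zero R_add R_smul R_mul)
open B9Thm311DeltaPrimeSymm (avgCoeffY_eq_ite cornerY_levY_eq)
open B9Thm311ProjectionR (XinvY_comp_XY_parSymY RY_parSymY_idempotent QpY_GpY_RY_parSymY)
open B9Thm311DeltaPrimePos (isUnit_deltaPrimeAY_parSymY)
open B9Eq3132SectDLetters (gaugePiY gaugePiTY)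
open OpsYNablaBridge (divY_gradY_apply)
open scoped Matrix

noncomputable section

variable {d ℓ : ℕ} {hd : 1 ≤ d + 1} {hL : Odd (ℓ + 1) ∧ 1 < ℓ + 1} {b₀ b₁ : ℝ}

/-! ## §1 The averaging term of `Δ′_a(U)` is `Q′(U)* Â Q′(U)` at the symmetrised transporter -/

section Factor

variable {𝔸 : Type} [NormedRing 𝔸] [NormedAlgebra ℂ 𝔸] [CompleteSpace 𝔸]
variable (i : KIdx d ℓ hd hL b₀ b₁)

/-- multiplication of a block function by a real block weight (ℂ-linear). [cite: Balaban1985BackgroundPropagators, (3.24) p.394 («a_j (L^jη)^{−2}»), dictionary] -/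
def blkScaleY (a : BlkY i → ℝ) : (BlkY i → 𝔸) →ₗ[ℂ] (BlkY i → 𝔸) where
  toFun Φ := fun s => ((a s : ℝ) : ℂ) • Φ s
  map_add' Φ Ψ := by
    funext s
    simp only [Pi.add_apply, smul_add]
  map_smul' c Φ := by
    funext s
    rw [Pi.smul_apply, Pi.smul_apply, RingHom.id_apply, smul_comm]

omit [CompleteSpace 𝔸] in
/-- the block weight, evaluated. [cite: Balaban1985BackgroundPropagators, (3.24) p.394, bookkeeping] -/
@[simp] theorem blkScaleY_apply (a : BlkY i → ℝ) (Φ : BlkY i → 𝔸) (s : BlkY i) : blkScaleY i a Φ s = ((a s : ℝ) : ℂ) • Φ s := rfl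

/-- **the weight `Â(s) = a_{j(s)} · W(s)`** of the factorisation: NODE 00's level coefficient `levC` of the block's level times the block volume
`W(s) = (L^{j(s)})^{d+1}` (which cancels the normalisation `W(s)⁻¹` of the average `Q′`). [cite: Balaban1985BackgroundPropagators, (3.24) p.394;
Balaban1984PropagatorsII, (2.13)–(2.14) p.225] -/
def avgWtY : BlkY i → ℝ := fun s => levC d ℓ (aPrinted ℓ 1) s.1.1 * W i.D.toDomains s

omit [NormedAlgebra ℂ 𝔸] [CompleteSpace 𝔸] in
/-- `R(V)` of a finite sum. [cite: Balaban1985BackgroundPropagators, (3.19) p.393, bookkeeping] -/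
private theorem R_finset_sum {ι : Type} (V : 𝔸ˣ) (s : Finset ι) (f : ι → 𝔸) : R V (∑ x ∈ s, f x) = ∑ x ∈ s, R V (f x) :=
  map_sum (⟨⟨R V, R_zero V⟩, R_add V⟩ : 𝔸 →+ 𝔸) f s

/-- the coefficient bookkeeping: `Â(s(z)) · q′(s(z), w) = avgCoeff(z, w)`. [cite: Balaban1985BackgroundPropagators, (3.24) p.394; Balaban1984PropagatorsII, (2.14) p.225] -/
theorem avgWtY_mul_qpK (z w : SiteY i) : avgWtY i (blkOf i.D.toDomains z) * qpK i (blkOf i.D.toDomains z) w = avgCoeffY i z w := by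
  show avgWtY i (blkOf i.D.toDomains z) * (if blkOf i.D.toDomains w = blkOf i.D.toDomains z then (W i.D.toDomains (blkOf i.D.toDomains z))⁻¹ else 0)
    = avgCoeffY i z w
  rw [avgCoeffY_eq_ite]
  by_cases hw : blkOf i.D.toDomains w = blkOf i.D.toDomains z
  · have hl : levY i z = (blkOf i.D.toDomains z).1.1 := lev_eq_of_blkOf_eq i.D.toDomains rfl
    rw [if_pos hw, if_pos hw, avgWtY, mul_assoc, mul_inv_cancel₀ (W_pos _ _).ne', mul_one, hl]
  · rw [if_neg hw, if_neg hw, mul_zero]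

/-- the transporter bookkeeping: `U(Γ_{c,z})⁻¹ · U(Γ_{c,w}) = avgTr(z, w)` (`c` the corner of the block of `z`), by the inverse-symmetry of `parSymY`.
[cite: Balaban1985BackgroundPropagators, (3.19) p.393, (3.24) p.394] -/
theorem qpT_inv_mul_qpT_parSymY (U : CfgY 𝔸 i) (z w : SiteY i) :
    (qpT i (parSymY i) U (blkOf i.D.toDomains z) z)⁻¹ * qpT i (parSymY i) U (blkOf i.D.toDomains z) w = avgTrY i (parSymY i) U z w := by
  show (parSymY i U (blkCornerY i (blkOf i.D.toDomains z)) z)⁻¹ * parSymY i U (blkCornerY i (blkOf i.D.toDomains z)) w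
      = parSymY i U z (cornerY i (levY i z) z) * parSymY i U (cornerY i (levY i z) z) w
  rw [cornerY_levY_eq, parSymY_swap U (blkCornerY i (blkOf i.D.toDomains z)) z]

/-- ★★ **(3.24) BY NAME: the averaging term of `Δ′_a(U)` IS `Q′(U)* Â Q′(U)`** at the symmetrised transporter, for every configuration.
[cite: Balaban1985BackgroundPropagators, (3.24) p.394, (3.19) p.393] -/
theorem avgKernelY_parSymY_eq (U : CfgY 𝔸 i) :
    kernelTrOpY (avgCoeffY i) (avgTrY i (parSymY i) U) = QpsY i (parSymY i) U ∘ₗ blkScaleY i (avgWtY i) ∘ₗ QpY i (parSymY i) U := by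
  refine LinearMap.ext fun Λ => funext fun z => ?_
  rw [kernelTrOpY_apply, LinearMap.comp_apply, LinearMap.comp_apply, QpsY, trLiftY_apply,
    Finset.sum_eq_single (blkOf i.D.toDomains z)]
  · have hq1 : qpsK i z (blkOf i.D.toDomains z) = 1 := by
      show (if blkOf i.D.toDomains z = blkOf i.D.toDomains z then (1 : ℝ) else 0) = 1
      exact if_pos rfl
    rw [hq1, Complex.ofReal_one, one_smul, blkScaleY_apply, QpY, trLiftY_apply, R_smul, R_finset_sum, Finset.smul_sum]
    refine Finset.sum_congr rfl fun w _ => ?_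
    rw [R_smul, ← B9Eq39Adjoint.R_mul, qpT_inv_mul_qpT_parSymY, smul_smul, ← Complex.ofReal_mul, avgWtY_mul_qpK]
  · intro s _ hs
    have hq0 : qpsK i z s = 0 := by
      show (if blkOf i.D.toDomains z = s then (1 : ℝ) else 0) = 0
      exact if_neg fun h => hs h.symm
    rw [hq0, Complex.ofReal_zero, zero_smul]
  · intro h
    exact absurd (Finset.mem_univ _) h

/-- ★★ **`Δ′_a(U) = Δ_U + Q′(U)* Â Q′(U)`** — (3.24) as print writes it, at the symmetrised transporter. [cite: Balaban1985BackgroundPropagators, (3.24) p.394] -/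
theorem deltaPrimeAY_parSymY_eq (U : CfgY 𝔸 i) :
    deltaPrimeAY i (parSymY i) U = lapSL i U + QpsY i (parSymY i) U ∘ₗ blkScaleY i (avgWtY i) ∘ₗ QpY i (parSymY i) U := by
  rw [deltaPrimeAY, avgKernelY_parSymY_eq]

/-- **(3.23) as operators: `D*_U ∘ D_U = c_f² • Δ_U`** (def-Y's `divY_gradY_apply`, bundled). [cite: Balaban1985BackgroundPropagators, (3.23) p.394] -/
theorem divY_comp_gradY (U : CfgY 𝔸 i) : divY i U ∘ₗ gradY i U = ((i.cf ^ 2 : ℝ) : ℂ) • lapSL i U :=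
  LinearMap.ext fun Φ => funext fun z => by
    rw [LinearMap.comp_apply, divY_gradY_apply, LinearMap.smul_apply, Pi.smul_apply, lapSL_apply]

/-- in print's units (`c_f η = 1`): **`G′_phys ∘ D*_U D_U = G′ ∘ Δ_U`**. [cite: Balaban1985BackgroundPropagators, (3.23)–(3.25) p.394] -/
theorem GpPhysY_comp_divY_gradY (parS : SiteParY 𝔸 i) (hcf : i.cf * etaS i = 1) (U : CfgY 𝔸 i) :
    GpPhysY i parS U ∘ₗ divY i U ∘ₗ gradY i U = GpY i parS U ∘ₗ lapSL i U := by
  have h1 : etaS i ^ 2 * i.cf ^ 2 = 1 := by rw [← mul_pow, mul_comm, hcf, one_pow]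
  rw [divY_comp_gradY, GpPhysY_apply, LinearMap.smul_comp, LinearMap.comp_smul, smul_smul, ← Complex.ofReal_mul, h1, Complex.ofReal_one, one_smul]

/-- in print's units: **`D*_U D_U ∘ G′_phys = Δ_U ∘ G′`**. [cite: Balaban1985BackgroundPropagators, (3.23)–(3.25) p.394] -/
theorem divY_gradY_comp_GpPhysY (parS : SiteParY 𝔸 i) (hcf : i.cf * etaS i = 1) (U : CfgY 𝔸 i) :
    divY i U ∘ₗ gradY i U ∘ₗ GpPhysY i parS U = lapSL i U ∘ₗ GpY i parS U := by
  have h1 : i.cf ^ 2 * etaS i ^ 2 = 1 := by rw [← mul_pow, hcf, one_pow]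
  rw [← LinearMap.comp_assoc, divY_comp_gradY, GpPhysY_apply, LinearMap.smul_comp, LinearMap.comp_smul, smul_smul, ← Complex.ofReal_mul, h1,
    Complex.ofReal_one, one_smul]

end Factor

/-! ## §2 At a `G`-valued background, `G ≤ U(N)`: `R G′ Q′* = 0`, `R G′ Δ_U R = R`, and the gauge modes `D G′ R f` are killed by (3.119) -/

section Projection

open scoped Matrix.Norms.L2Operator

variable {N : ℕ} (i : KIdx d ℓ hd hL b₀ b₁) {G : Subgroup (Matrix (Fin N) (Fin N) ℂ)ˣ}

/-- ★ **`R(U) G′(U) Q′(U)* = 0`** — the mirror of n06-j's `Q′G′R = 0` (`R = 1 − G′Q′*X⁻¹Q′G′`, `X = Q′G′²Q′*`, `X⁻¹X = 1`).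
[cite: Balaban1985BackgroundPropagators, (3.20)–(3.21) p.394, (3.25) p.395] -/
theorem RY_GpY_QpsY_parSymY (hG : G ≤ B7Prop2Explicit.unitaryUnits (Matrix (Fin N) (Fin N) ℂ)) {U : CfgY (Matrix (Fin N) (Fin N) ℂ) i}
    (hU : ∀ μ x, U μ x ∈ G) :
    RY i (parSymY i) (GpY i (parSymY i)) U ∘ₗ GpY i (parSymY i) U ∘ₗ QpsY i (parSymY i) U = 0 := by
  set Gp := GpY i (parSymY i) U
  set Qp := QpY i (parSymY i) U
  set Qps := QpsY i (parSymY i) U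
  set Xi := XinvY i (parSymY i) (GpY i (parSymY i)) U
  have hkey : Xi ∘ₗ (Qp ∘ₗ (Gp ∘ₗ (Gp ∘ₗ Qps))) = LinearMap.id := by
    have h := XinvY_comp_XY_parSymY i hG hU
    simp only [XY] at h
    exact h
  have hP : (Gp ∘ₗ (Qps ∘ₗ (Xi ∘ₗ (Qp ∘ₗ Gp)))) ∘ₗ (Gp ∘ₗ Qps) = Gp ∘ₗ Qps := by
    simp only [LinearMap.comp_assoc]
    rw [hkey, LinearMap.comp_id]
  have hR : RY i (parSymY i) (GpY i (parSymY i)) U = LinearMap.id - Gp ∘ₗ (Qps ∘ₗ (Xi ∘ₗ (Qp ∘ₗ Gp))) := rfl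
  rw [hR, LinearMap.sub_comp, LinearMap.id_comp, hP, sub_self]

/-- `R G′ (Q′*ÂQ′) = 0`: the averaging term of `Δ′_a` is invisible to `R G′` from the left. [cite: Balaban1985BackgroundPropagators, (3.24)–(3.25) p.394] -/
theorem RY_GpY_avgKernel_parSymY (hG : G ≤ B7Prop2Explicit.unitaryUnits (Matrix (Fin N) (Fin N) ℂ)) {U : CfgY (Matrix (Fin N) (Fin N) ℂ) i}
    (hU : ∀ μ x, U μ x ∈ G) :
    RY i (parSymY i) (GpY i (parSymY i)) U ∘ₗ GpY i (parSymY i) U ∘ₗ kernelTrOpY (avgCoeffY i) (avgTrY i (parSymY i) U) = 0 := by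
  rw [avgKernelY_parSymY_eq]
  calc RY i (parSymY i) (GpY i (parSymY i)) U ∘ₗ GpY i (parSymY i) U ∘ₗ QpsY i (parSymY i) U ∘ₗ blkScaleY i (avgWtY i) ∘ₗ QpY i (parSymY i) U
      = (RY i (parSymY i) (GpY i (parSymY i)) U ∘ₗ GpY i (parSymY i) U ∘ₗ QpsY i (parSymY i) U) ∘ₗ (blkScaleY i (avgWtY i) ∘ₗ QpY i (parSymY i) U) := by
        simp only [LinearMap.comp_assoc]
    _ = 0 := by rw [RY_GpY_QpsY_parSymY i hG hU, LinearMap.zero_comp]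

/-- `(Q′*ÂQ′) G′ R = 0`: … and to `G′ R` from the right (n06-j's `Q′G′R = 0`). [cite: Balaban1985BackgroundPropagators, (3.24)–(3.25) p.394] -/
theorem avgKernel_GpY_RY_parSymY (hG : G ≤ B7Prop2Explicit.unitaryUnits (Matrix (Fin N) (Fin N) ℂ)) {U : CfgY (Matrix (Fin N) (Fin N) ℂ) i}
    (hU : ∀ μ x, U μ x ∈ G) :
    kernelTrOpY (avgCoeffY i) (avgTrY i (parSymY i) U) ∘ₗ GpY i (parSymY i) U ∘ₗ RY i (parSymY i) (GpY i (parSymY i)) U = 0 := by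
  rw [avgKernelY_parSymY_eq]
  simp only [LinearMap.comp_assoc]
  rw [QpY_GpY_RY_parSymY i hG hU, LinearMap.comp_zero, LinearMap.comp_zero]

/-- `G′(U) Δ_U = 1 − G′(U)(Q′*ÂQ′)(U)` (`G′ = (Δ′_a)⁻¹`, `Δ′_a = Δ_U + Q′*ÂQ′`, `Δ′_a` a unit at every `G`-valued `U`).
[cite: Balaban1985BackgroundPropagators, (3.24)–(3.25) p.394] -/
theorem GpY_comp_lapSL_parSymY (hG : G ≤ B7Prop2Explicit.unitaryUnits (Matrix (Fin N) (Fin N) ℂ)) {U : CfgY (Matrix (Fin N) (Fin N) ℂ) i}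
    (hU : ∀ μ x, U μ x ∈ G) :
    GpY i (parSymY i) U ∘ₗ lapSL i U = LinearMap.id - GpY i (parSymY i) U ∘ₗ kernelTrOpY (avgCoeffY i) (avgTrY i (parSymY i) U) := by
  have h1 : GpY i (parSymY i) U ∘ₗ deltaPrimeAY i (parSymY i) U = LinearMap.id :=
    GpY_mul_deltaPrimeAY i (parSymY i) U (isUnit_deltaPrimeAY_parSymY i hG hU)
  rw [eq_sub_iff_add_eq, ← LinearMap.comp_add, ← h1]
  rfl

/-- `Δ_U G′(U) = 1 − (Q′*ÂQ′)(U) G′(U)`. [cite: Balaban1985BackgroundPropagators, (3.24)–(3.25) p.394] -/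
theorem lapSL_comp_GpY_parSymY (hG : G ≤ B7Prop2Explicit.unitaryUnits (Matrix (Fin N) (Fin N) ℂ)) {U : CfgY (Matrix (Fin N) (Fin N) ℂ) i}
    (hU : ∀ μ x, U μ x ∈ G) :
    lapSL i U ∘ₗ GpY i (parSymY i) U = LinearMap.id - kernelTrOpY (avgCoeffY i) (avgTrY i (parSymY i) U) ∘ₗ GpY i (parSymY i) U := by
  have h1 : deltaPrimeAY i (parSymY i) U ∘ₗ GpY i (parSymY i) U = LinearMap.id :=
    deltaPrimeAY_mul_GpY i (parSymY i) U (isUnit_deltaPrimeAY_parSymY i hG hU)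
  rw [eq_sub_iff_add_eq, ← LinearMap.add_comp, ← h1]
  rfl

/-- ★ **`R G′ Δ_U R = R`** at every `G`-valued background: `R G′ Δ_U R = R·R − R G′ (Q′*ÂQ′) R = R − 0`.
[cite: Balaban1985BackgroundPropagators, (3.24)–(3.25) p.394, p.425 («{A : RD*A = 0}»)] -/
theorem RY_GpY_lapSL_RY_parSymY (hG : G ≤ B7Prop2Explicit.unitaryUnits (Matrix (Fin N) (Fin N) ℂ)) {U : CfgY (Matrix (Fin N) (Fin N) ℂ) i}
    (hU : ∀ μ x, U μ x ∈ G) :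
    RY i (parSymY i) (GpY i (parSymY i)) U ∘ₗ GpY i (parSymY i) U ∘ₗ lapSL i U ∘ₗ RY i (parSymY i) (GpY i (parSymY i)) U
      = RY i (parSymY i) (GpY i (parSymY i)) U := by
  set Rr := RY i (parSymY i) (GpY i (parSymY i)) U
  calc Rr ∘ₗ GpY i (parSymY i) U ∘ₗ lapSL i U ∘ₗ Rr = Rr ∘ₗ (GpY i (parSymY i) U ∘ₗ lapSL i U) ∘ₗ Rr := by
        simp only [LinearMap.comp_assoc]
    _ = Rr ∘ₗ Rr - (Rr ∘ₗ GpY i (parSymY i) U ∘ₗ kernelTrOpY (avgCoeffY i) (avgTrY i (parSymY i) U)) ∘ₗ Rr := by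
        rw [GpY_comp_lapSL_parSymY i hG hU, LinearMap.sub_comp, LinearMap.id_comp, LinearMap.comp_sub]
        simp only [LinearMap.comp_assoc]
    _ = Rr := by rw [RY_parSymY_idempotent i hG hU, RY_GpY_avgKernel_parSymY i hG hU, LinearMap.zero_comp, sub_zero]

/-- ★ **`R Δ_U G′ R = R`** (the mirror). [cite: Balaban1985BackgroundPropagators, (3.24)–(3.25) p.394, p.425] -/
theorem RY_lapSL_GpY_RY_parSymY (hG : G ≤ B7Prop2Explicit.unitaryUnits (Matrix (Fin N) (Fin N) ℂ)) {U : CfgY (Matrix (Fin N) (Fin N) ℂ) i}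
    (hU : ∀ μ x, U μ x ∈ G) :
    RY i (parSymY i) (GpY i (parSymY i)) U ∘ₗ lapSL i U ∘ₗ GpY i (parSymY i) U ∘ₗ RY i (parSymY i) (GpY i (parSymY i)) U
      = RY i (parSymY i) (GpY i (parSymY i)) U := by
  set Rr := RY i (parSymY i) (GpY i (parSymY i)) U
  calc Rr ∘ₗ lapSL i U ∘ₗ GpY i (parSymY i) U ∘ₗ Rr = Rr ∘ₗ (lapSL i U ∘ₗ GpY i (parSymY i) U) ∘ₗ Rr := by
        simp only [LinearMap.comp_assoc]
    _ = Rr ∘ₗ Rr - Rr ∘ₗ (kernelTrOpY (avgCoeffY i) (avgTrY i (parSymY i) U) ∘ₗ GpY i (parSymY i) U ∘ₗ Rr) := by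
        rw [lapSL_comp_GpY_parSymY i hG hU, LinearMap.sub_comp, LinearMap.id_comp, LinearMap.comp_sub]
        simp only [LinearMap.comp_assoc]
    _ = Rr := by rw [RY_parSymY_idempotent i hG hU, avgKernel_GpY_RY_parSymY i hG hU, LinearMap.comp_zero, sub_zero]

/-- ★★ **`R G′_phys D*_U D_U R = R`** in print's units — at the record's letters `R = RY (parSymY) (GpPhysY (parSymY))` (= `RY … (GpY …)`,
`RY_GpPhysY`), for every census member (`c_f η = 1`, `MemberY.hcfk`) and every `G`-valued background.
[cite: Balaban1985BackgroundPropagators, (3.21)–(3.25) p.394, p.425] -/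
theorem RY_GpPhysY_divY_gradY_RY (hG : G ≤ B7Prop2Explicit.unitaryUnits (Matrix (Fin N) (Fin N) ℂ)) (hcf : i.cf * etaS i = 1)
    {U : CfgY (Matrix (Fin N) (Fin N) ℂ) i} (hU : ∀ μ x, U μ x ∈ G) :
    RY i (parSymY i) (GpPhysY i (parSymY i)) U ∘ₗ GpPhysY i (parSymY i) U ∘ₗ divY i U ∘ₗ gradY i U ∘ₗ RY i (parSymY i) (GpPhysY i (parSymY i)) U
      = RY i (parSymY i) (GpPhysY i (parSymY i)) U := by
  rw [RY_GpPhysY]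
  calc RY i (parSymY i) (GpY i (parSymY i)) U ∘ₗ GpPhysY i (parSymY i) U ∘ₗ divY i U ∘ₗ gradY i U ∘ₗ RY i (parSymY i) (GpY i (parSymY i)) U
      = RY i (parSymY i) (GpY i (parSymY i)) U ∘ₗ (GpPhysY i (parSymY i) U ∘ₗ divY i U ∘ₗ gradY i U) ∘ₗ RY i (parSymY i) (GpY i (parSymY i)) U := by
        simp only [LinearMap.comp_assoc]
    _ = RY i (parSymY i) (GpY i (parSymY i)) U := by
        rw [GpPhysY_comp_divY_gradY i (parSymY i) hcf U]
        simpa only [LinearMap.comp_assoc] using RY_GpY_lapSL_RY_parSymY i hG hU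

/-- ★★ **`R D*_U D_U G′_phys R = R`** in print's units. [cite: Balaban1985BackgroundPropagators, (3.21)–(3.25) p.394, p.425] -/
theorem RY_divY_gradY_GpPhysY_RY (hG : G ≤ B7Prop2Explicit.unitaryUnits (Matrix (Fin N) (Fin N) ℂ)) (hcf : i.cf * etaS i = 1)
    {U : CfgY (Matrix (Fin N) (Fin N) ℂ) i} (hU : ∀ μ x, U μ x ∈ G) :
    RY i (parSymY i) (GpPhysY i (parSymY i)) U ∘ₗ divY i U ∘ₗ gradY i U ∘ₗ GpPhysY i (parSymY i) U ∘ₗ RY i (parSymY i) (GpPhysY i (parSymY i)) U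
      = RY i (parSymY i) (GpPhysY i (parSymY i)) U := by
  rw [RY_GpPhysY]
  calc RY i (parSymY i) (GpY i (parSymY i)) U ∘ₗ divY i U ∘ₗ gradY i U ∘ₗ GpPhysY i (parSymY i) U ∘ₗ RY i (parSymY i) (GpY i (parSymY i)) U
      = RY i (parSymY i) (GpY i (parSymY i)) U ∘ₗ (divY i U ∘ₗ gradY i U ∘ₗ GpPhysY i (parSymY i) U) ∘ₗ RY i (parSymY i) (GpY i (parSymY i)) U := by
        simp only [LinearMap.comp_assoc]
    _ = RY i (parSymY i) (GpY i (parSymY i)) U := by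
        rw [divY_gradY_comp_GpPhysY i (parSymY i) hcf U]
        simpa only [LinearMap.comp_assoc] using RY_lapSL_GpY_RY_parSymY i hG hU

/-- ★★ **`R G′ D* ∘ (1 − D R G′ D*) = 0`**: `R G′ D*` annihilates the range of the adjoint gauge projection `gaugePiTY` of (3.119) — print p. 425:
the operator 𝔓 projects onto `{A : R D* A = 0}`. [cite: Balaban1985BackgroundPropagators, (3.119) p.419, (3.147) p.425] -/
theorem RY_GpPhysY_divY_gaugePiTY (hG : G ≤ B7Prop2Explicit.unitaryUnits (Matrix (Fin N) (Fin N) ℂ)) (hcf : i.cf * etaS i = 1)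
    {U : CfgY (Matrix (Fin N) (Fin N) ℂ) i} (hU : ∀ μ x, U μ x ∈ G) :
    RY i (parSymY i) (GpPhysY i (parSymY i)) U ∘ₗ GpPhysY i (parSymY i) U ∘ₗ divY i U ∘ₗ gaugePiTY i (parSymY i) (GpPhysY i (parSymY i)) U = 0 := by
  have hkey := RY_GpPhysY_divY_gradY_RY i hG hcf hU
  have hT : gaugePiTY i (parSymY i) (GpPhysY i (parSymY i)) U
      = LinearMap.id - gradY i U ∘ₗ RY i (parSymY i) (GpPhysY i (parSymY i)) U ∘ₗ GpPhysY i (parSymY i) U ∘ₗ divY i U := rfl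
  -- reassociate with EXPLICIT `comp_assoc` rewrites (a `simp only [LinearMap.comp_assoc]` normal form of the 7-fold chain is a kernel hog here)
  rw [hT, LinearMap.comp_sub, LinearMap.comp_sub, LinearMap.comp_sub, LinearMap.comp_id,
    ← LinearMap.comp_assoc (GpPhysY i (parSymY i) U ∘ₗ divY i U), ← LinearMap.comp_assoc (GpPhysY i (parSymY i) U ∘ₗ divY i U),
    ← LinearMap.comp_assoc (GpPhysY i (parSymY i) U ∘ₗ divY i U), ← LinearMap.comp_assoc (GpPhysY i (parSymY i) U ∘ₗ divY i U), hkey, sub_self]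

/-- ★★ **`(1 − D G′ R D*) ∘ D G′ R = 0`**: the gauge projection `gaugePiY` of (3.119) kills the gauge modes `D_U G′ R f`.
[cite: Balaban1985BackgroundPropagators, (3.119) p.419, (3.147) p.425] -/
theorem gaugePiY_gradY_GpPhysY_RY (hG : G ≤ B7Prop2Explicit.unitaryUnits (Matrix (Fin N) (Fin N) ℂ)) (hcf : i.cf * etaS i = 1)
    {U : CfgY (Matrix (Fin N) (Fin N) ℂ) i} (hU : ∀ μ x, U μ x ∈ G) :
    gaugePiY i (parSymY i) (GpPhysY i (parSymY i)) U ∘ₗ gradY i U ∘ₗ GpPhysY i (parSymY i) U ∘ₗ RY i (parSymY i) (GpPhysY i (parSymY i)) U = 0 := by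
  have hkey := RY_divY_gradY_GpPhysY_RY i hG hcf hU
  have h : (gradY i U ∘ₗ GpPhysY i (parSymY i) U ∘ₗ RY i (parSymY i) (GpPhysY i (parSymY i)) U ∘ₗ divY i U) ∘ₗ
        (gradY i U ∘ₗ GpPhysY i (parSymY i) U ∘ₗ RY i (parSymY i) (GpPhysY i (parSymY i)) U)
      = gradY i U ∘ₗ GpPhysY i (parSymY i) U ∘ₗ (RY i (parSymY i) (GpPhysY i (parSymY i)) U ∘ₗ divY i U ∘ₗ gradY i U ∘ₗ
          GpPhysY i (parSymY i) U ∘ₗ RY i (parSymY i) (GpPhysY i (parSymY i)) U) := by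
    simp only [LinearMap.comp_assoc]
  have hP : gaugePiY i (parSymY i) (GpPhysY i (parSymY i)) U
      = LinearMap.id - gradY i U ∘ₗ GpPhysY i (parSymY i) U ∘ₗ RY i (parSymY i) (GpPhysY i (parSymY i)) U ∘ₗ divY i U := rfl
  rw [hP, LinearMap.sub_comp, LinearMap.id_comp, h, hkey, sub_self]

end Projection

end

end Literature.MathematicalPhysics.QuantumFieldTheory.Balaban1983to89.Node00
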